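import Summits.HubbardSuperconductivity.HubbardSuperconductivity.Theorems.FunctionFieldCertificateNecessaryPoleOrderTwist
import Summits.HubbardSuperconductivity.HubbardSuperconductivity.Theorems.BalabanIRBirEveryGroundStateAffine
import Literature.MathematicalPhysics.QuantumLattice.LiebFluxPhaseGauge
import Literature.MathematicalPhysics.QuantumLattice.HubbardRingPerronFrobeniusProofs
import HarnessLib

/-!
# Route `FunctionFieldCertificate` — support item `NecessaryPoleOrder`
# (stmt-HubbardSuperconductivity-7792): twisted evaluation on the Hubbard torus

Companion of `FunctionFieldCertificateNecessaryPoleOrderTwist.lean` (the model-independent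
twisted evaluation of a `TorusSymbolCertificate`). Here the hypotheses of
`symbolCertificate_twisted_order_expectation_ge` are discharged for the route's instance
`SymbolCertificate U δ deg p a = TorusSymbolCertificate (hubbardMomentumModel U δ) deg p a`:
`H_L = hubbardTorus 2 L 1 U` is Hermitian (`LiebThm1.hamiltonian_isHermitian`); a `U(1)` gauge
transformation `W = orbitalPhase g` (`|g| = 1`; for the necessary-pole lemma
`g (x, σ) = exp(2πi j x₁/L)`, the Lieb–Schultz–Mattis twist `U_j`) is unitary
(`LiebFluxPhaseGauge`) and, being diagonal in the occupation-number basis, maps the sector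
`szSector N_L 0` into itself together with its adjoint (`orbitalPhase_mulVec_mem_szSector`);
a sector ground state `IsGroundStateInSector H_L N_L 0 ψ` is an eigenvector at the bottom of
the sector spectrum (`minEnergyOn_mul_re_le`). Results:

* `hubbardSymbolCertificate_twisted_order_expectation_ge` — for every twist cost `D` with `Wᴴ H_L W = H_L + D`:
  `a - C/L + (KKT twist defects) + Re (R-channel twist defect) ≤ L⁻⁴ Re ⟨Wψ, Δ_d† Δ_d Wψ⟩`;
* `hubbardSymbolCertificate_order_expectation_ge` — no twist: `a - C/L ≤ L⁻⁴ Re ⟨ψ, Δ_d† Δ_d ψ⟩` in every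
  normalised `(N_L, 0)`-sector ground state, `L ≥ L₀` even (soundness of the finitely presented
  certificate; the hypothesis of the route's `CertificateCompleteness` with `a - C/L`).

What remains for the route's `NecessaryPoleOrder` (not here): the explicit twist cost of
`hubbardTorus` under `U_j` (phases `e^{±2πij/L} - 1` on the `e₁`-bonds), the `O(j/L)` defect
bounds for graded symbol-class families, and the pair-sum-rule pigeonhole
`min_{j ≤ J₀} L⁻⁴ ‖Δ_d(2j e₁) ψ‖² ≤ 32/J₀`. No definition is introduced.
-/

namespace Summit.HubbardSuperconductivity.HubbardSuperconductivity.Theorems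

-- the problem namespace `HubbardSuperconductivity.HubbardSuperconductivity` is the tree's layout (D-0017)
set_option linter.dupNamespace false

open Matrix Finset Literature.MathematicalPhysics.QuantumLattice Literature.Probability.LatticeModels
open scoped ComplexOrder ComplexConjugate


section Hubbard

/-- A gauge transformation `orbitalPhase g` (diagonal in the occupation-number basis) maps the
sector `(N, S^z) = (2n, 0)` into itself. [folklore] -/
theorem orbitalPhase_mulVec_mem_szSector {Λ : Type*} [LinearOrder Λ] [Fintype Λ]
    (g : Orb Λ → ℂ) {n : ℕ} {ψ : Fock (Orb Λ)} (hψ : ψ ∈ szSector (2 * n) 0) :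
    orbitalPhase g *ᵥ ψ ∈ szSector (2 * n) 0 := by
  rw [mem_szSector_two_mul_zero_iff] at hψ ⊢
  exact PreservesSectors.isInSector_mulVec (PreservesSectors.diagonal _) hψ

/-- The adjoint of a gauge transformation is the gauge transformation with conjugate phases.
[folklore] -/
theorem conjTranspose_orbitalPhase {ι : Type*} [LinearOrder ι] [Fintype ι] (g : ι → ℂ) :
    (orbitalPhase g)ᴴ = orbitalPhase (fun i => star (g i)) := by
  rw [orbitalPhase, diagonal_conjTranspose, orbitalPhase]
  congr 1
  funext s
  rw [Pi.star_apply, star_prod]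

/-- `Wᴴ (W x) = x` for the gauge transformation `W = orbitalPhase g`, `|g| = 1` (vector form of
`conjTranspose_orbitalPhase_mul`, free of the `DecidableEq` instance carried by `1`). [folklore] -/
theorem orbitalPhase_conjTranspose_mulVec_mulVec {ι : Type*} [LinearOrder ι] [Fintype ι]
    {g : ι → ℂ} (hg : ∀ i, ‖g i‖ = 1) (x : Finset ι → ℂ) :
    (orbitalPhase g)ᴴ *ᵥ (orbitalPhase g *ᵥ x) = x := by
  rw [mulVec_mulVec, conjTranspose_orbitalPhase_mul hg, one_mulVec]

/-- `W (Wᴴ x) = x` for the gauge transformation `W = orbitalPhase g`, `|g| = 1` (vector form of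
`orbitalPhase_mul_conjTranspose`). [folklore] -/
theorem orbitalPhase_mulVec_conjTranspose_mulVec {ι : Type*} [LinearOrder ι] [Fintype ι]
    {g : ι → ℂ} (hg : ∀ i, ‖g i‖ = 1) (x : Finset ι → ℂ) :
    orbitalPhase g *ᵥ ((orbitalPhase g)ᴴ *ᵥ x) = x := by
  rw [mulVec_mulVec, orbitalPhase_mul_conjTranspose hg, one_mulVec]

/-- **The twisted evaluation of a function-field certificate of `d`-wave pair order on the Hubbard
torus.** For `c : SymbolCertificate U δ deg p a`, an even side `L ≥ L₀`, a `U(1)` gauge twist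
`W = orbitalPhase g` (`|g| = 1`; for the route: `g (x, σ) = exp(2πi j x₁ / L)`, the
Lieb–Schultz–Mattis twist `U_j`) with twist cost `D` (`Wᴴ H_L W = H_L + D`, `H_L = hubbardTorus 2 L 1 U`),
and every normalised ground state `ψ` of `H_L` in the sector `(N_L, S^z = 0)`,
`N_L = 2⌊(1-δ)L²/2⌋`:
`a - C/L + (KKT twist defects) + Re (R-channel twist defect) ≤ L⁻⁴ Re ⟨Wψ, Δ_d† Δ_d Wψ⟩`.
Specialisation of `symbolCertificate_twisted_order_expectation_ge` (`H_L` is Hermitian, `W` is unitary and, being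
diagonal in the occupation basis, preserves the sector together with `Wᴴ`; the sector ground state
is an eigenvector at the bottom of the sector spectrum, `minEnergyOn_mul_re_le`). [folklore] -/
theorem hubbardSymbolCertificate_twisted_order_expectation_ge {U δ a : ℚ} {deg p : ℕ}
    (c : SymbolCertificate U δ deg p a) (L : ℕ) [NeZero L] (hL : c.L₀ ≤ L) (hE : Even L)
    {g : Orb (FermionTorus 2 L) → ℂ} (hg : ∀ i, ‖g i‖ = 1)
    {D : Matrix (Finset (Orb (FermionTorus 2 L))) (Finset (Orb (FermionTorus 2 L))) ℂ}
    (hD : (orbitalPhase g)ᴴ * hubbardTorus 2 L 1 (U : ℝ) * orbitalPhase g =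
      hubbardTorus 2 L 1 (U : ℝ) + D)
    {ψ : Fock (Orb (FermionTorus 2 L))} (hψ1 : star ψ ⬝ᵥ ψ = 1)
    (hgs : IsGroundStateInSector (hubbardTorus 2 L 1 (U : ℝ))
      (2 * ⌊(1 - (δ : ℝ)) * (L : ℝ) ^ 2 / 2⌋₊) 0 ψ) :
    (a : ℝ) - c.C / L
      + (c.kkt.map fun F => ∑ κ : Fin F.arity → TorusSite 2 L, (F.weight.eval L κ).re *
          (star (((orbitalPhase g)ᴴ * F.op.eval (hubbardMomentumModel U δ) L κ * orbitalPhase g)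
              *ᵥ ψ) ⬝ᵥ
            (D * ((orbitalPhase g)ᴴ * F.op.eval (hubbardMomentumModel U δ) L κ * orbitalPhase g) -
              ((orbitalPhase g)ᴴ * F.op.eval (hubbardMomentumModel U δ) L κ * orbitalPhase g) * D)
              *ᵥ ψ).re).sum
      + (star ψ ⬝ᵥ
          (D * ((orbitalPhase g)ᴴ * weightedSum (hubbardMomentumModel U δ) c.rch L * orbitalPhase g) -
            ((orbitalPhase g)ᴴ * weightedSum (hubbardMomentumModel U δ) c.rch L * orbitalPhase g) * D)
          *ᵥ ψ).re
      ≤ (star (orbitalPhase g *ᵥ ψ) ⬝ᵥ ((1 / (L : ℂ) ^ 4) •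
          ((pairField dWaveFormFactor L)ᴴ * pairField dWaveFormFactor L)) *ᵥ
            (orbitalPhase g *ᵥ ψ)).re := by
  obtain ⟨hψK, -, hHψ⟩ := hgs
  exact symbolCertificate_twisted_order_expectation_ge c L hL hE
    (LiebThm1.hamiltonian_isHermitian (fermionTorusGraph 2 L) 1 (U : ℝ))
    (orbitalPhase_conjTranspose_mulVec_mulVec hg) (orbitalPhase_mulVec_conjTranspose_mulVec hg) hD
    (fun φ hφ => orbitalPhase_mulVec_mem_szSector g hφ)
    (fun φ hφ => by
      rw [conjTranspose_orbitalPhase]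
      exact orbitalPhase_mulVec_mem_szSector _ hφ)
    hψK hψ1 hHψ (fun φ hφ => minEnergyOn_mul_re_le _ _ hφ)

/-- **Soundness on the Hubbard torus** (no twist): a function-field certificate
`c : SymbolCertificate U δ deg p a` forces `a - C/L ≤ L⁻⁴ Re ⟨ψ, Δ_d† Δ_d ψ⟩` in every normalised
`(N_L, S^z = 0)`-sector ground state of `hubbardTorus 2 L 1 U`, `L ≥ L₀` even — the hypothesis of
the route's `CertificateCompleteness` with `a - C/L` in place of `a`. [folklore] -/
theorem hubbardSymbolCertificate_order_expectation_ge {U δ a : ℚ} {deg p : ℕ}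
    (c : SymbolCertificate U δ deg p a) (L : ℕ) [NeZero L] (hL : c.L₀ ≤ L) (hE : Even L)
    {ψ : Fock (Orb (FermionTorus 2 L))} (hψ1 : star ψ ⬝ᵥ ψ = 1)
    (hgs : IsGroundStateInSector (hubbardTorus 2 L 1 (U : ℝ))
      (2 * ⌊(1 - (δ : ℝ)) * (L : ℝ) ^ 2 / 2⌋₊) 0 ψ) :
    (a : ℝ) - c.C / L ≤ (star ψ ⬝ᵥ ((1 / (L : ℂ) ^ 4) •
          ((pairField dWaveFormFactor L)ᴴ * pairField dWaveFormFactor L)) *ᵥ ψ).re := by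
  obtain ⟨hψK, -, hHψ⟩ := hgs
  exact symbolCertificate_order_expectation_ge c L hL hE
    (LiebThm1.hamiltonian_isHermitian (fermionTorusGraph 2 L) 1 (U : ℝ))
    hψK hψ1 hHψ (fun φ hφ => minEnergyOn_mul_re_le _ _ hφ)

end Hubbard

end Summit.HubbardSuperconductivity.HubbardSuperconductivity.Theorems
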